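import Literature.NumberTheory.QuadraticFields.InfrastructureFundUnit
import Literature.Computability.Cryptography.UnitResidueFloat
import HarnessLib

/-!
# The unit-residue algorithm, I: baby step, giant step and reduction with float bookkeeping

Topic `Computability/Cryptography` (the polynomial-time classical half of the "Pell face" of
`HallgrenPell.lean`: from the integer part of the regulator to the fundamental unit modulo `m`,
Jacobson–Williams, *Solving the Pell Equation*, Ch. 12). The abstract algorithm walks the principal
cycle of `𝒪_Δ` with the frames of `NumberTheory/QuadraticFields/Infrastructure*.lean`, carrying

* the frame `(a, b, p, r)` (coordinates `p, r` of `θ, θψ`; the machine keeps them modulo `m`),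
* the sign of `θ` and a float `(M, E)` for `|θ|` (`UnitResidueFloat.lean`),

and this file defines and analyses its three moves — each with the exact effect on `θ` and the
accuracy budget of the float:

* `bstepF` — the baby step `ρ`: `θ ↦ θψ`, accuracy `ε ↦ ε + 5/2^P` (`Good.bstepF`);
* `sqF` — the giant step (squaring with the exact small Bezout pairs `bezout`): `θ ↦ θ²/g > 0`,
  accuracy `ε ↦ 2ε + 9/2^P` (`Good.sqF`);
* `rstepF`, `reduceF` — the reduction rounds: `|θ| ↦ |θ| · Γ` with `1/(2Δ a) ≤ Γ ≤ 1`, sign flips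
  recorded, accuracy `+ 5/2^P` per executed round (`GoodI.reduceF`).

The static data are bundled in `Prm` (`Δ`, precision `P`, shift `q`, `Sq = ⌊2^q √Δ⌋`), validity in
`Prm.OK`. Everything is proved; no named facts. The walk/level/final phases and the main theorem are
in `UnitResidueAlgorithm.lean`; the register machine in `UnitResidueMachine.lean`.

## References

* M. J. Jacobson, Jr., H. C. Williams, *Solving the Pell Equation*, CMS Books in Mathematics, Springer
  (2009), Ch. 12 (compact representations: §12.1 Alg. 12.1 EWNEAR, §12.2 Alg. 12.6 CR), Ch. 11
  ((f, p) representations), §5.4, §7.4. [JacobsonWilliams2008]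
-/

noncomputable section

open scoped Classical

namespace Literature.Computability.Cryptography.UnitResidue

open Literature.NumberTheory.QuadraticFields.Infra

/-! ### Static parameters -/

/-- Static data of a run: the discriminant, the float precision `P`, the shift `q` and
`Sq = ⌊2^q √Δ⌋`. [cite: JacobsonWilliams2008, §12.2 (inputs of CR)] -/
structure Prm where
  /-- the discriminant -/
  Δ : ℕ
  /-- float precision -/
  P : ℕ
  /-- the shift used to approximate `b + √Δ` by integers -/
  q : ℕ
  /-- `⌊2^q √Δ⌋` -/
  Sq : ℤ

/-- Validity of the static data. [folklore] -/
structure Prm.OK (pm : Prm) : Prop where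
  disc : IsDisc pm.Δ
  fund : IsFundDisc pm.Δ
  sq_def : pm.Sq = Nat.sqrt (pm.Δ * 4 ^ pm.q)
  q_large : pm.P + Nat.size pm.Δ + 6 ≤ pm.q
  P_large : Nat.size pm.Δ + 2 ≤ pm.P
  five_le : 5 ≤ pm.Δ

variable {pm : Prm}

/-- `Δ < 2^{size Δ}` as reals, hence `√Δ < 2^{size Δ}` and more. [folklore] -/
theorem Prm.OK.rt_lt (h : pm.OK) : rt pm.Δ < (2 : ℝ) ^ Nat.size pm.Δ := by
  have h1 : (pm.Δ : ℝ) < (2 : ℝ) ^ Nat.size pm.Δ := by exact_mod_cast Nat.lt_size_self pm.Δ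
  have h2 : (1 : ℝ) ≤ (2 : ℝ) ^ Nat.size pm.Δ := one_le_pow₀ (by norm_num)
  have hs := rt_pos h.disc
  have hss := rt_sq pm.Δ
  nlinarith

/-- **`Sq = ⌊2^q √Δ⌋`**: `Sq ≤ 2^q √Δ < Sq + 1`. [folklore] -/
theorem Prm.OK.sq_bounds (h : pm.OK) :
    (pm.Sq : ℝ) ≤ (2 : ℝ) ^ pm.q * rt pm.Δ ∧ (2 : ℝ) ^ pm.q * rt pm.Δ < pm.Sq + 1 := by
  have e : Real.sqrt ((pm.Δ * 4 ^ pm.q : ℕ) : ℝ) = (2 : ℝ) ^ pm.q * rt pm.Δ := by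
    push_cast
    rw [show ((4 : ℝ) ^ pm.q) = ((2 : ℝ) ^ pm.q) ^ 2 by rw [← pow_mul, mul_comm, pow_mul]; norm_num,
      Real.sqrt_mul' _ (by positivity), Real.sqrt_sq (by positivity)]
    unfold rt; ring
  rw [h.sq_def]
  push_cast
  rw [← e]
  exact ⟨Real.nat_sqrt_le_real_sqrt, Real.real_sqrt_lt_nat_sqrt_succ⟩

/-! ### The factor float of a frame: `|b + √Δ|/2a` -/

/-- Integer numerator `|b 2^q + Sq| ≈ |b + √Δ| 2^q`. [cite: JacobsonWilliams2008, §12.1 (EWNEAR: (a + b√D)/r)] -/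
def facU (pm : Prm) (b : ℤ) : ℤ := |b * 2 ^ pm.q + pm.Sq|

/-- Integer denominator `a 2^{q+1}`. [folklore] -/
def facV (pm : Prm) (a : ℕ) : ℤ := a * 2 ^ (pm.q + 1)

/-- The float of `|b + √Δ|/2a`. [folklore] -/
def facF (pm : Prm) (a : ℕ) (b : ℤ) : ℤ × ℤ := floatOf pm.P (facU pm b) (facV pm a)

/-- `|u - U| ≤ 1` for `u = |b 2^q + Sq|`, `U = |b + √Δ| 2^q`. [folklore] -/
theorem Prm.OK.facU_sub (h : pm.OK) (b : ℤ) :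
    |(facU pm b : ℝ) - |(b : ℝ) + rt pm.Δ| * (2 : ℝ) ^ pm.q| ≤ 1 := by
  obtain ⟨h1, h2⟩ := h.sq_bounds
  unfold facU
  push_cast
  have e : |(b : ℝ) * 2 ^ pm.q + 2 ^ pm.q * rt pm.Δ| = |(b : ℝ) + rt pm.Δ| * (2 : ℝ) ^ pm.q := by
    rw [show (b : ℝ) * 2 ^ pm.q + 2 ^ pm.q * rt pm.Δ = ((b : ℝ) + rt pm.Δ) * 2 ^ pm.q by ring, abs_mul,
      abs_of_pos (by positivity : (0 : ℝ) < (2 : ℝ) ^ pm.q)]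
  rw [← e]
  have := abs_abs_sub_abs_le_abs_sub ((b : ℝ) * 2 ^ pm.q + pm.Sq) ((b : ℝ) * 2 ^ pm.q + 2 ^ pm.q * rt pm.Δ)
  refine this.trans ?_
  rw [abs_le]; constructor <;> linarith

/-- **Accuracy of the factor float**: if `|b + √Δ| 2^q ≥ 2^{P+2}` and `|b| + √Δ < 2a·2^{P+1}`
then `facF` is within `3/2^P` of `|b + √Δ|/2a` in `log₂`. [cite: JacobsonWilliams2008, §11.1, §12.1] -/
theorem Prm.OK.acc_facF (h : pm.OK) {a : ℕ} {b : ℤ} (ha : 1 ≤ a)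
    (hU : (2 : ℝ) ^ (pm.P + 2) ≤ |(b : ℝ) + rt pm.Δ| * (2 : ℝ) ^ pm.q)
    (hsmall : |(b : ℝ)| + rt pm.Δ + 1 < (a : ℝ) * (2 : ℝ) ^ (pm.P + 2)) :
    Acc pm.P (facF pm a b).1 (facF pm a b).2 (|(b : ℝ) + rt pm.Δ| / (2 * a)) (3 / (2 : ℝ) ^ pm.P) := by
  set U := |(b : ℝ) + rt pm.Δ| * (2 : ℝ) ^ pm.q with hUdef
  have hsub := h.facU_sub b
  rw [← hUdef] at hsub
  have hP4 : (4 : ℝ) ≤ (2 : ℝ) ^ (pm.P + 2) := by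
    calc (4 : ℝ) = 2 ^ 2 := by norm_num
      _ ≤ 2 ^ (pm.P + 2) := pow_le_pow_right₀ (by norm_num) (by omega)
  have hUpos : 0 < U := by linarith
  -- integrality bounds for `floatOf`
  have hu1 : 1 ≤ facU pm b := by
    have : (2 : ℝ) ≤ facU pm b := by rw [abs_le] at hsub; linarith
    exact_mod_cast (show (1 : ℝ) ≤ facU pm b by linarith)
  have hv1 : 1 ≤ facV pm a := by
    unfold facV
    have h2 : (0 : ℤ) < 2 ^ (pm.q + 1) := by positivity
    have ha' : (1 : ℤ) ≤ a := by exact_mod_cast ha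
    nlinarith
  have hsz : isize (facU pm b) ≤ pm.P + 3 + isize (facV pm a) := by
    -- `u ≤ (|b| + √Δ + 1) 2^q < a 2^{P+2} 2^q = facV · 2^{P+1}`, and `size (v 2^{P+1}) ≤ size v + P + 1`
    have hu_real : (facU pm b : ℝ) < (facV pm a : ℝ) * (2 : ℝ) ^ (pm.P + 1) := by
      have h1 : (facU pm b : ℝ) ≤ U + 1 := by rw [abs_le] at hsub; linarith
      have h2 : U ≤ (|(b : ℝ)| + rt pm.Δ) * (2 : ℝ) ^ pm.q := by
        rw [hUdef]; gcongr; exact (abs_add_le _ _).trans (by rw [abs_of_pos (rt_pos h.disc)])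
      have h3 : (1 : ℝ) ≤ (2 : ℝ) ^ pm.q := one_le_pow₀ (by norm_num)
      unfold facV; push_cast
      have : (|(b : ℝ)| + rt pm.Δ + 1) * (2 : ℝ) ^ pm.q < (a : ℝ) * (2 : ℝ) ^ (pm.P + 2) * (2 : ℝ) ^ pm.q := by
        gcongr
      calc (facU pm b : ℝ) ≤ U + 1 := h1
        _ ≤ (|(b : ℝ)| + rt pm.Δ) * (2 : ℝ) ^ pm.q + 1 * (2 : ℝ) ^ pm.q := by nlinarith
        _ = (|(b : ℝ)| + rt pm.Δ + 1) * (2 : ℝ) ^ pm.q := by ring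
        _ < (a : ℝ) * (2 : ℝ) ^ (pm.P + 2) * (2 : ℝ) ^ pm.q := this
        _ = (a : ℝ) * 2 ^ (pm.q + 1) * (2 : ℝ) ^ (pm.P + 1) := by ring
    have hu_int : facU pm b < facV pm a * 2 ^ (pm.P + 1) := by exact_mod_cast hu_real
    have hv0 : 0 ≤ facV pm a := by omega
    have hvs := lt_two_pow_isize hv0
    rw [isize_le_iff (by omega)]
    calc facU pm b < facV pm a * 2 ^ (pm.P + 1) := hu_int
      _ ≤ 2 ^ isize (facV pm a) * 2 ^ (pm.P + 1) := by gcongr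
      _ = 2 ^ (isize (facV pm a) + (pm.P + 1)) := by rw [← pow_add]
      _ ≤ 2 ^ (pm.P + 3 + isize (facV pm a)) := pow_le_pow_right₀ (by norm_num) (by omega)
  have hacc := acc_floatOf (P := pm.P) hu1 hv1 hsz
  -- transfer from `u/v` to `U/v = |b + √Δ|/2a`
  have hv_real : (facV pm a : ℝ) = (a : ℝ) * 2 ^ (pm.q + 1) := by unfold facV; push_cast; ring
  have ha_real : (1 : ℝ) ≤ a := by exact_mod_cast ha
  have hvpos : (0 : ℝ) < facV pm a := by rw [hv_real]; exact mul_pos (by linarith) (by positivity)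
  have htarget : U / (facV pm a : ℝ) = |(b : ℝ) + rt pm.Δ| / (2 * a) := by
    rw [hv_real, hUdef, pow_succ]; field_simp
  have habs : 0 < |(b : ℝ) + rt pm.Δ| := by
    by_contra hc
    push Not at hc
    have : U ≤ 0 := by rw [hUdef]; exact mul_nonpos_of_nonpos_of_nonneg hc (by positivity)
    linarith
  have hlog : |Real.logb 2 ((facU pm b : ℝ) / facV pm a) - Real.logb 2 (U / facV pm a)| ≤ 4 / (2 : ℝ) ^ (pm.P + 2) := by
    rw [Real.logb_div (by exact_mod_cast (show (facU pm b) ≠ 0 by omega)) hvpos.ne',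
      Real.logb_div hUpos.ne' hvpos.ne']
    have := abs_logb_sub_logb_le (k := pm.P + 2) (by omega) hU hsub
    calc _ = |Real.logb 2 (facU pm b : ℝ) - Real.logb 2 U| := by ring_nf
      _ ≤ _ := this
  have := hacc.congr_right (by rw [htarget]; exact div_pos habs (by linarith)) hlog
  rw [htarget] at this
  refine this.mono ?_
  rw [pow_add]
  have : (0 : ℝ) < (2 : ℝ) ^ pm.P := by positivity
  field_simp
  nlinarith

/-- `|b + √Δ| ≥ 1/(|b| + √Δ)` for every integer `b` (as `|Δ - b²| ≥ 1`). [folklore] -/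
theorem Prm.OK.abs_add_rt_ge (h : pm.OK) (b : ℤ) : 1 ≤ |(b : ℝ) + rt pm.Δ| * (|(b : ℝ)| + rt pm.Δ) := by
  have hs := rt_pos h.disc
  have hss := rt_sq pm.Δ
  have hne : (pm.Δ : ℤ) - b ^ 2 ≠ 0 := by
    intro h0
    apply h.disc.nsq
    refine ⟨b.natAbs, ?_⟩
    have : ((b.natAbs ^ 2 : ℕ) : ℤ) = pm.Δ := by push_cast; rw [sq_abs]; linarith
    have : b.natAbs ^ 2 = pm.Δ := by exact_mod_cast this
    rw [← this, pow_two]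
  have h1 : (1 : ℝ) ≤ |((pm.Δ : ℤ) - b ^ 2 : ℤ)| := by exact_mod_cast Int.one_le_abs hne
  push_cast at h1
  rw [← hss, show rt pm.Δ ^ 2 - (b : ℝ) ^ 2 = ((b : ℝ) + rt pm.Δ) * (rt pm.Δ - b) by ring, abs_mul] at h1
  have h2 : |rt pm.Δ - b| ≤ |(b : ℝ)| + rt pm.Δ := by
    rw [abs_le]; constructor
    · linarith [le_abs_self (b : ℝ)]
    · linarith [neg_abs_le (b : ℝ)]
  calc (1 : ℝ) ≤ |(b : ℝ) + rt pm.Δ| * |rt pm.Δ - b| := h1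
    _ ≤ |(b : ℝ) + rt pm.Δ| * (|(b : ℝ)| + rt pm.Δ) := by gcongr

/-- **The factor float is accurate on every frame of the run**: `|b| ≤ Δ` and `a ≥ 1` suffice for the
hypotheses of `acc_facF` when, in addition, `|b| + √Δ + 1 < a 2^{P+2}`. [cite: JacobsonWilliams2008, §12.1] -/
theorem Prm.OK.acc_facF' (h : pm.OK) {a : ℕ} {b : ℤ} (ha : 1 ≤ a) (hb : |b| ≤ (pm.Δ : ℤ))
    (hsmall : |(b : ℝ)| + rt pm.Δ + 1 < (a : ℝ) * (2 : ℝ) ^ (pm.P + 2)) :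
    Acc pm.P (facF pm a b).1 (facF pm a b).2 (|(b : ℝ) + rt pm.Δ| / (2 * a)) (3 / (2 : ℝ) ^ pm.P) := by
  apply h.acc_facF ha _ hsmall
  -- `|b + √Δ| ≥ 1/(|b| + √Δ) ≥ 1/(2 · 2^{size Δ})`, and `q ≥ P + size Δ + 3`
  have h1 := h.abs_add_rt_ge b
  have hsz := h.rt_lt
  have hbR : |(b : ℝ)| ≤ pm.Δ := by rw [← Int.cast_abs]; exact_mod_cast hb
  have hΔ : (pm.Δ : ℝ) < (2 : ℝ) ^ Nat.size pm.Δ := by exact_mod_cast Nat.lt_size_self pm.Δ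
  have hden : |(b : ℝ)| + rt pm.Δ < (2 : ℝ) ^ (Nat.size pm.Δ + 1) := by rw [pow_succ]; linarith
  have hq : pm.P + 2 + (Nat.size pm.Δ + 1) ≤ pm.q := by have := h.q_large; omega
  have hpos : 0 < |(b : ℝ)| + rt pm.Δ := by have := rt_pos h.disc; positivity
  -- `2^{P+2} · (|b| + √Δ) < 2^{P+2} 2^{size Δ + 1} ≤ 2^q ≤ |b + √Δ| (|b| + √Δ) 2^q`
  have key : (2 : ℝ) ^ (pm.P + 2) * (|(b : ℝ)| + rt pm.Δ) ≤ |(b : ℝ) + rt pm.Δ| * (2 : ℝ) ^ pm.q * (|(b : ℝ)| + rt pm.Δ) := by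
    calc (2 : ℝ) ^ (pm.P + 2) * (|(b : ℝ)| + rt pm.Δ) ≤ (2 : ℝ) ^ (pm.P + 2) * (2 : ℝ) ^ (Nat.size pm.Δ + 1) := by
          gcongr
      _ = (2 : ℝ) ^ (pm.P + 2 + (Nat.size pm.Δ + 1)) := by rw [← pow_add]
      _ ≤ (2 : ℝ) ^ pm.q := pow_le_pow_right₀ (by norm_num) hq
      _ ≤ (2 : ℝ) ^ pm.q * (|(b : ℝ) + rt pm.Δ| * (|(b : ℝ)| + rt pm.Δ)) := le_mul_of_one_le_right (by positivity) h1
      _ = |(b : ℝ) + rt pm.Δ| * (2 : ℝ) ^ pm.q * (|(b : ℝ)| + rt pm.Δ) := by ring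
  exact le_of_mul_le_mul_right key hpos

/-! ### States and the baby step -/

/-- A state of the walk: frame, sign of `θ`, float `(M, E)` for `|θ|`. [cite: JacobsonWilliams2008, §12.1–12.2] -/
structure AS where
  /-- the frame `(a, b, p, r)` -/
  fr : St
  /-- the sign of `θ = ev p` -/
  sgn : ℤ
  /-- float mantissa -/
  M : ℤ
  /-- float exponent -/
  E : ℤ

/-- The float after multiplication by the factor `|b + √Δ|/2a` of the current frame. [folklore] -/
def AS.mulFac (pm : Prm) (s : AS) : ℤ × ℤ :=
  mulF pm.P s.M s.E (facF pm s.fr.a s.fr.b).1 (facF pm s.fr.a s.fr.b).2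

/-- **The baby step with bookkeeping**: `ρ` on the frame, float times `ψ`. [cite: JacobsonWilliams2008, §12.1 (Alg. 12.1)] -/
def bstepF (pm : Prm) (s : AS) : AS := ⟨bstep pm.Δ s.fr, s.sgn, (s.mulFac pm).1, (s.mulFac pm).2⟩

/-- Invariant of a state (frame invariant, sign, accuracy `ε`), reducedness not required.
[cite: JacobsonWilliams2008, §11.1 (reduced (f, p) representation without "reduced")] -/
structure GoodI (pm : Prm) (s : AS) (ε : ℝ) : Prop where
  inv : Inv pm.Δ s.fr
  sgn : s.sgn = 1 ∨ s.sgn = -1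
  pos : 0 < s.sgn * ev pm.Δ (rt pm.Δ) s.fr.p
  acc : Acc pm.P s.M s.E |ev pm.Δ (rt pm.Δ) s.fr.p| ε

/-- A good state: invariant, REDUCED frame, sign, accuracy. [cite: JacobsonWilliams2008, §11.1 Def. 11.1] -/
structure Good (pm : Prm) (s : AS) (ε : ℝ) : Prop extends GoodI pm s ε where
  red : Red pm.Δ s.fr

/-- The sign is `±1`, so `sgn · θ > 0` means `|θ| = sgn · θ`. [folklore] -/
theorem GoodI.abs_eq {s : AS} {ε : ℝ} (hg : GoodI pm s ε) :
    |ev pm.Δ (rt pm.Δ) s.fr.p| = s.sgn * ev pm.Δ (rt pm.Δ) s.fr.p := by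
  have hp := hg.pos
  rcases hg.sgn with h | h <;> rw [h] at hp ⊢ <;> push_cast at hp ⊢
  · rw [one_mul] at hp ⊢; exact abs_of_pos hp
  · rw [abs_of_neg (by linarith)]; ring

/-- In a reduced frame `|b| ≤ Δ` and `|b| + √Δ + 1 < a 2^{P+2}`. [folklore] -/
theorem Prm.OK.red_fac_hyps (h : pm.OK) {S : St} (hI : Inv pm.Δ S) (hR : Red pm.Δ S) :
    |S.b| ≤ (pm.Δ : ℤ) ∧ |(S.b : ℝ)| + rt pm.Δ + 1 < (S.a : ℝ) * (2 : ℝ) ^ (pm.P + 2) := by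
  have hb1 := hR.b_pos
  have hb2 := hR.b_sq_lt
  have hbs := hR.2
  have hsz := h.rt_lt
  have hP := h.P_large
  have ha : (1 : ℝ) ≤ S.a := by exact_mod_cast hI.1
  constructor
  · rw [abs_of_pos (by omega)]; nlinarith
  · have hbR : |(S.b : ℝ)| < rt pm.Δ := by
      rw [abs_of_pos (by exact_mod_cast (show (0:ℤ) < S.b by omega))]; exact hbs
    have h4 : (2 : ℝ) ^ Nat.size pm.Δ * 4 ≤ (2 : ℝ) ^ (pm.P + 2) := by
      rw [show (4 : ℝ) = 2 ^ 2 by norm_num, ← pow_add]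
      exact pow_le_pow_right₀ (by norm_num) (by omega)
    have h1 : (1 : ℝ) ≤ (2 : ℝ) ^ Nat.size pm.Δ := one_le_pow₀ (by norm_num)
    nlinarith

/-- **The baby step preserves good states** and multiplies `θ` by `ψ > 1`; the accuracy degrades
by `5/2^P`. [cite: JacobsonWilliams2008, §12.1 (Alg. 12.1 EWNEAR), §11.1 Lemma 11.3] -/
theorem Good.bstepF_spec (h : pm.OK) {s : AS} {ε : ℝ} (hg : Good pm s ε) :
    Good pm (bstepF pm s) (ε + 5 / (2 : ℝ) ^ pm.P) ∧
      ev pm.Δ (rt pm.Δ) (UnitResidue.bstepF pm s).fr.p = ev pm.Δ (rt pm.Δ) s.fr.p * s.fr.psi (rt pm.Δ) ∧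
      1 < s.fr.psi (rt pm.Δ) := by
  have hI := hg.inv
  have hR := hg.red
  obtain ⟨hψ1, _, _⟩ := hR.psi_bounds hI.1
  have hev : ev pm.Δ (rt pm.Δ) (UnitResidue.bstepF pm s).fr.p = ev pm.Δ (rt pm.Δ) s.fr.p * s.fr.psi (rt pm.Δ) :=
    hI.ev_bstep_p (rt_sq _)
  obtain ⟨hb, hsmall⟩ := h.red_fac_hyps hI hR
  have hfac := h.acc_facF' hI.1 hb hsmall
  have hψ : |(s.fr.b : ℝ) + rt pm.Δ| / (2 * s.fr.a) = s.fr.psi (rt pm.Δ) := by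
    unfold St.psi
    rw [abs_of_pos]
    have := hR.b_pos
    have : (0 : ℝ) < s.fr.b := by exact_mod_cast (show (0:ℤ) < s.fr.b by omega)
    linarith [rt_pos h.disc]
  rw [hψ] at hfac
  have hacc := hg.acc.mulF hfac
  refine ⟨⟨⟨hI.bstep hR, hg.sgn, ?_, ?_⟩, hR.bstep h.disc hI⟩, hev, hψ1⟩
  · show 0 < (s.sgn : ℝ) * ev pm.Δ (rt pm.Δ) (UnitResidue.bstepF pm s).fr.p
    rw [hev, ← mul_assoc]
    exact mul_pos hg.pos (by linarith)
  · show Acc pm.P (s.mulFac pm).1 (s.mulFac pm).2 |ev pm.Δ (rt pm.Δ) (UnitResidue.bstepF pm s).fr.p| _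
    rw [hev, abs_mul, abs_of_pos (by linarith : (0:ℝ) < s.fr.psi (rt pm.Δ))]
    refine hacc.mono ?_
    have : (0:ℝ) < (2:ℝ) ^ pm.P := by positivity
    apply le_of_eq; field_simp; ring

/-! ### Reduction rounds with bookkeeping -/

/-- **One reduction round with bookkeeping**: stop if reduced; else step, normalise, multiply the
float by `|ψ|` of the (normalised) frame and flip the sign when `b > √Δ`.
[cite: JacobsonWilliams2008, §5.2, §12.1] -/
def rstepF (pm : Prm) (s : AS) : AS :=
  if RedTest pm.Δ s.fr then s else
    ⟨normalize pm.Δ (pstep pm.Δ s.fr), if (Nat.sqrt pm.Δ : ℤ) < s.fr.b then -s.sgn else s.sgn,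
      (s.mulFac pm).1, (s.mulFac pm).2⟩

/-- **The reduction with bookkeeping**: normalise, then `n` rounds. [cite: JacobsonWilliams2008, §5.2] -/
def reduceF (pm : Prm) (s : AS) (n : ℕ) : AS := (rstepF pm)^[n] ⟨normalize pm.Δ s.fr, s.sgn, s.M, s.E⟩

/-- `reduceF` unfolds one round at the end. [folklore] -/
theorem reduceF_succ (s : AS) (n : ℕ) : reduceF pm s (n + 1) = rstepF pm (reduceF pm s n) := by
  unfold reduceF; rw [Function.iterate_succ_apply']

/-- The frame of one bookkeeping round is one loop round. [folklore] -/
theorem rstepF_fr (s : AS) : (rstepF pm s).fr = rloop pm.Δ s.fr := by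
  unfold rstepF rloop
  by_cases hred : RedTest pm.Δ s.fr
  · rw [if_pos hred, if_pos hred]
  · rw [if_neg hred, if_neg hred]

/-- The frame of `reduceF` is `reduce`. [folklore] -/
theorem reduceF_fr (s : AS) (n : ℕ) : (reduceF pm s n).fr = reduce pm.Δ s.fr n := by
  induction n with
  | zero => rfl
  | succ n ih => rw [reduceF_succ, reduce_succ, rstepF_fr, ih]

/-- Along the reduction the frames satisfy the bookkeeping invariant `RedInv` and stay normalised
with `a ≤ a₀`. [cite: JacobsonWilliams2008, §5.1 (5.6)] -/
theorem redInv_reduceF (h : pm.OK) {s : AS} (hI : Inv pm.Δ s.fr) (n : ℕ) :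
    RedInv pm.Δ s.fr (reduceF pm s n).fr n := by
  rw [reduceF_fr]
  induction n with
  | zero => exact hI.redInv_zero h.disc
  | succ n ih => rw [reduce_succ]; exact ih.succ h.disc

/-- In a normalised frame of the reduction, `|b| ≤ Δ` and `|b| + √Δ + 1 < a 2^{P+2}` provided
`a ≤ Δ`. [folklore] -/
theorem Prm.OK.norm_fac_hyps (h : pm.OK) {T : St} (hI : Inv pm.Δ T) (hN : Norm pm.Δ T)
    (haΔ : (T.a : ℤ) < pm.Δ) :
    |T.b| ≤ (pm.Δ : ℤ) ∧ |(T.b : ℝ)| + rt pm.Δ + 1 < (T.a : ℝ) * (2 : ℝ) ^ (pm.P + 2) := by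
  obtain ⟨hs1, hs2⟩ := nat_sqrt_lt_rt h.disc
  obtain ⟨hN2, _⟩ := nat_sqrt_sq_lt h.disc
  have ha1 : (1 : ℤ) ≤ T.a := by exact_mod_cast hI.1
  have hP := h.P_large
  have hΔsz : (pm.Δ : ℝ) < (2 : ℝ) ^ Nat.size pm.Δ := by exact_mod_cast Nat.lt_size_self pm.Δ
  have h4 : (2 : ℝ) ^ Nat.size pm.Δ * 4 ≤ (2 : ℝ) ^ (pm.P + 2) := by
    rw [show (4 : ℝ) = 2 ^ 2 by norm_num, ← pow_add]
    exact pow_le_pow_right₀ (by norm_num) (by omega)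
  have hsΔ : rt pm.Δ ≤ pm.Δ := by
    have h1 : (1 : ℝ) ≤ pm.Δ := by exact_mod_cast h.disc.one_le
    nlinarith [rt_sq pm.Δ, rt_pos h.disc]
  by_cases hbig : (Nat.sqrt pm.Δ : ℤ) < T.a
  · obtain ⟨hb1, hb2⟩ := hN.1 hbig
    have hbabs : |T.b| ≤ T.a := abs_le.mpr ⟨by omega, hb2⟩
    constructor
    · omega
    · have h1 : |(T.b : ℝ)| ≤ T.a := by rw [← Int.cast_abs]; exact_mod_cast hbabs
      have h2 : rt pm.Δ < T.a := by
        have : (Nat.sqrt pm.Δ : ℝ) + 1 ≤ T.a := by exact_mod_cast hbig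
        linarith
      have h3 : (4 : ℝ) ≤ (2 : ℝ) ^ (pm.P + 2) := by
        calc (4:ℝ) = 2 ^ 2 := by norm_num
          _ ≤ 2 ^ (pm.P + 2) := pow_le_pow_right₀ (by norm_num) (by omega)
      have ha : (1 : ℝ) ≤ T.a := by exact_mod_cast hI.1
      have hmul : (2 : ℝ) ^ (pm.P + 2) ≤ T.a * (2 : ℝ) ^ (pm.P + 2) := le_mul_of_one_le_left (by positivity) ha
      nlinarith
  · push Not at hbig
    obtain ⟨hb1, hb2⟩ := hN.2 hbig
    have hbabs : |T.b| ≤ Nat.sqrt pm.Δ := abs_le.mpr ⟨by omega, hb2⟩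
    constructor
    · have : (Nat.sqrt pm.Δ : ℤ) ≤ pm.Δ := by nlinarith
      omega
    · have h1 : |(T.b : ℝ)| ≤ Nat.sqrt pm.Δ := by rw [← Int.cast_abs]; exact_mod_cast hbabs
      have ha : (1 : ℝ) ≤ T.a := by exact_mod_cast hI.1
      have hmul : (2 : ℝ) ^ (pm.P + 2) ≤ T.a * (2 : ℝ) ^ (pm.P + 2) := le_mul_of_one_le_left (by positivity) ha
      have h1sz : (1 : ℝ) ≤ (2 : ℝ) ^ Nat.size pm.Δ := one_le_pow₀ (by norm_num)
      linarith

/-- **One reduction round preserves the invariant**; if it steps, `|θ|` is multiplied by `|ψ|` and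
the accuracy degrades by `5/2^P`. [cite: JacobsonWilliams2008, §5.2, §11.1 Lemma 11.3] -/
theorem GoodI.rstepF_spec (h : pm.OK) {s : AS} {ε : ℝ} (hg : GoodI pm s ε) (hN : Norm pm.Δ s.fr)
    (haΔ : (s.fr.a : ℤ) < pm.Δ) :
    GoodI pm (rstepF pm s) (ε + 5 / (2 : ℝ) ^ pm.P) := by
  have hI := hg.inv
  have hP : (0 : ℝ) < (2 : ℝ) ^ pm.P := by positivity
  unfold UnitResidue.rstepF
  by_cases hred : RedTest pm.Δ s.fr
  · rw [if_pos hred]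
    exact ⟨hI, hg.sgn, hg.pos, hg.acc.mono (le_add_of_nonneg_right (by positivity))⟩
  · rw [if_neg hred]
    obtain ⟨hb, hsmall⟩ := h.norm_fac_hyps hI hN haΔ
    have hfac := h.acc_facF' hI.1 hb hsmall
    have hψabs : |(s.fr.b : ℝ) + rt pm.Δ| / (2 * s.fr.a) = |s.fr.psi (rt pm.Δ)| := by
      have ha2 : (0 : ℝ) < 2 * (s.fr.a : ℝ) := by
        have : (1 : ℝ) ≤ s.fr.a := by exact_mod_cast hI.1
        linarith
      unfold St.psi
      rw [abs_div, abs_of_pos ha2]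
    rw [hψabs] at hfac
    have hacc := hg.acc.mulF hfac
    have habs : |ev pm.Δ (rt pm.Δ) (normalize pm.Δ (pstep pm.Δ s.fr)).p| =
        |ev pm.Δ (rt pm.Δ) s.fr.p| * |s.fr.psi (rt pm.Δ)| := by
      rw [normalize_p]; exact hI.abs_ev_pstep_p h.disc
    -- sign: `θ' (√Δ - b) = 2|c| θ`
    have hsgn_new : (if (Nat.sqrt pm.Δ : ℤ) < s.fr.b then -s.sgn else s.sgn) = 1 ∨
        (if (Nat.sqrt pm.Δ : ℤ) < s.fr.b then -s.sgn else s.sgn) = -1 := by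
      rcases hg.sgn with hs | hs <;> rw [hs] <;> split_ifs <;> simp
    have hkey := hI.ev_pstep_p h.disc
    have hc : (0 : ℝ) < |(s.fr.c pm.Δ : ℝ)| := by
      rw [← Int.cast_abs]; exact_mod_cast Int.one_le_abs (hI.c_ne_zero h.disc)
    obtain ⟨hs1, hs2⟩ := nat_sqrt_lt_rt h.disc
    refine ⟨(hI.pstep h.disc).normalize, hsgn_new, ?_, ?_⟩
    · show (0 : ℝ) < ((if (Nat.sqrt pm.Δ : ℤ) < s.fr.b then -s.sgn else s.sgn : ℤ) : ℝ) *
        ev pm.Δ (rt pm.Δ) (normalize pm.Δ (pstep pm.Δ s.fr)).p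
      rw [normalize_p]
      have hpos := hg.pos
      split_ifs with hb
      · -- `b > √Δ`: the factor `√Δ - b < 0` flips the sign
        have hneg : rt pm.Δ - s.fr.b < 0 := by
          have : (Nat.sqrt pm.Δ : ℝ) + 1 ≤ s.fr.b := by exact_mod_cast hb
          linarith
        push_cast
        have : ((s.sgn : ℝ) * ev pm.Δ (rt pm.Δ) (pstep pm.Δ s.fr).p) * (rt pm.Δ - s.fr.b) =
            2 * |(s.fr.c pm.Δ : ℝ)| * (s.sgn * ev pm.Δ (rt pm.Δ) s.fr.p) := by
          linear_combination (s.sgn : ℝ) * hkey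
        have h2 : 0 < ((s.sgn : ℝ) * ev pm.Δ (rt pm.Δ) (pstep pm.Δ s.fr).p) * (rt pm.Δ - s.fr.b) := by
          rw [this]; positivity
        have := (mul_pos_iff.mp h2)
        rcases this with ⟨_, h3⟩ | ⟨h3, _⟩
        · linarith
        · rw [neg_mul]; linarith
      · have hposf : 0 < rt pm.Δ - s.fr.b := by
          push Not at hb
          have : (s.fr.b : ℝ) ≤ Nat.sqrt pm.Δ := by exact_mod_cast hb
          linarith
        have : ((s.sgn : ℝ) * ev pm.Δ (rt pm.Δ) (pstep pm.Δ s.fr).p) * (rt pm.Δ - s.fr.b) =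
            2 * |(s.fr.c pm.Δ : ℝ)| * (s.sgn * ev pm.Δ (rt pm.Δ) s.fr.p) := by
          linear_combination (s.sgn : ℝ) * hkey
        have h2 : 0 < ((s.sgn : ℝ) * ev pm.Δ (rt pm.Δ) (pstep pm.Δ s.fr).p) * (rt pm.Δ - s.fr.b) := by
          rw [this]; positivity
        exact (mul_pos_iff_of_pos_right hposf).mp h2
    · show Acc pm.P (s.mulFac pm).1 (s.mulFac pm).2 |ev pm.Δ (rt pm.Δ) (normalize pm.Δ (pstep pm.Δ s.fr)).p| _
      rw [habs]
      refine hacc.mono (le_of_eq ?_)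
      field_simp; ring

end Literature.Computability.Cryptography.UnitResidue

end
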